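import Literature.MathematicalPhysics.QuantumFieldTheory.Balaban1983to89.B12NodeKnitRecord13SepCoPH

/-!
# BalabanUVNodes ∕ N09 — the Theorem-3 member over a transport whose images are gauge invariant AT EVERY POINT FOR EVERY INPUT: NO χ hypothesis, NO support,
# NO nesting, NO regular set — [B11] Thm 1's three binders ONLY (the kernel cost, on N09's side, of the located cure option «exactly gauge-covariant transport token»)

TRACK A (YM-PLAN §2b, node N09 = [B12] = [Balaban1987RG1] Thm 3 p. 264), WIDTH SEAT `pub-ymgap-dag-n09-w3` (g0; HUMAN RULING D-0149; plan g77 W-SEAT-START-LIST §n09 item 3),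
FILE 3.  Key of record it serves: K1⁷ `StabilityBAtRecordR13SepCoPH` = stmt-QuantumFields-20542 (`--supports`, count-neutral helper).  THEOREMS ONLY, def-free, sorry-free.

WHY.  FILES 1–2 of this seat (`…N09AtRecord13SepCoPHFluctNesting`, `…N09AtRecord13SepCoPHSupportAE`) trace the Stage-13 regular-set binders (F7a) ∕ (F7b) and the cut-off
invariance (M1) of N09's member to ONE fact: the β-layer token `TβOfRecord₁₃ = TcanOfRecord` (K0e's canonical version) is gauge invariant only ON the maximal regular set of
each input, and only for lift-invariant inputs.  dag-n09-e observed at Stage 10∕11 (`B12HInvUnconditional.hInvT_TcOfRecord_unconditional`) that a token whose images are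
gauge invariant EVERYWHERE (there: by the junk `0` of `contVersion`) makes `HInvT` unconditional.  THIS FILE records the generic statement behind both: over ANY transport
family `T'` with `GaugeInvariant (T' K j ρ)` for EVERY `K`, `j`, `ρ` («invariant output»), every effective action `A_k`, `k ≥ 0`, is gauge invariant with NO hypothesis
on `χ` (`A_0` is Wilson's; `A_{j+1} = log 𝐍_j⁻¹ (T' K j ρ_j)(·)` by dag-n09-a MODULE 1's one-step lemma), hence `HInvT` (g3's `hInvT_of_gaugeInvariant`), hence
`HCompT` from `HOrbit` (def-B's `hCompT_of_hOrbit_of_hInvT`, `hOrbit_of_hRestrict_of_unique`), hence the Theorem-3 member through the transport-generic plug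
(`B12NodeKnitIndAPlug.thm3Member_of_indATPlug_of_hCompT`) from (1.1) on the domains, `HRestrict` and intermediate uniqueness ALONE — N07's content; (M1), (F7a),
(F7b) do not occur.  The intended inhabitant of «invariant output» is the located cure option (b) of this seat's memo `HOME/pub-ymgap-dag-n09-w3/N09-ITEM3-MEMO.md`:
the Γ-AVERAGED canonical-version transport `T♮ K k ρ := canonVersion (V ↦ ∫ transportOfRecord K k ρ (V^γ) dγ)` (Γ = the compact gauge group of `T^{(k+1)}`) —
exactly invariant at every point for every `ρ`, a version of the transform for a.e.-lift-invariant `ρ`, equal to `TcanOfRecord` on `regSetOfRecord` — TYPED by this seat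
as the Node00 DEFINITION module `Node00/InvariantTransportOfRecord.lean` (`TinvOfRecord`, `gaugeInvariant_TinvOfRecord` = this file's `hT`; draft on plan g78's word,
definition lane on the type owner's word — NOT imported here, so this file stays token-free).  A6: the hypothesis class is inhabited in-file by the ZERO transport
(`invariantOutput_zero`; honest degenerate witness — it certifies non-vacuity of the STATEMENT, not the intended token).

WHAT THIS FILE PROVES (6 theorems): `invariantOutput_zero`, `gaugeInvariant_effActionHT_of_invariantOutput`, `hInvT_of_invariantOutput`, `hCompT_of_invariantOutput`,
`thm3Member_of_indATPlug_of_invariantOutput`, `b12_main_of_indATPlug_of_leaf_of_invariantOutput`.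

HONEST FRAMING: count-neutral kernel bookkeeping BY NAME; NO estimate of Bałaban's; [B11] Thm 1's binders DISPLAYED; the Stage-13 record's token `TcanOfRecord` does NOT
have invariant output (so nothing here instantiates at the v1.7 record); N09 NOT discharged; K0⁷ ∕ K1⁷ NOT closed; counts unmoved (typed 28∕28 · discharged 5∕27);
one finite four-torus programme at fixed ε — R4 closes the conditional rung `BalabanLadder.UV` only; NOT ℝ⁴ ∕ infinite volume ∕ OS ∕ mass gap ∕ Clay.
-/

noncomputable section

namespace Summit.QuantumFields.YangMills.BalabanUVNodes.N09InvariantTransportPlug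

open MeasureTheory Set
open Literature.MathematicalPhysics.QuantumFieldTheory.Balaban1983to89
open Literature.MathematicalPhysics.QuantumFieldTheory.Balaban1983to89.T4Continuum (T4Family)
open Literature.MathematicalPhysics.QuantumFieldTheory.Balaban1983to89.DagBinding (WorldP leavesP)
open Literature.MathematicalPhysics.QuantumFieldTheory.Balaban1983to89.Node00
open Literature.MathematicalPhysics.QuantumFieldTheory.Balaban1983to89.FlowStep (HBeta prefixOf)
open Literature.MathematicalPhysics.QuantumFieldTheory.Balaban1983to89.FlowStepRuns (genSeq genFlow)
open Literature.MathematicalPhysics.QuantumFieldTheory.Balaban1983to89.T4FlagMemory (extd)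
open Literature.MathematicalPhysics.QuantumFieldTheory.Balaban1983to89.B12Eq019ActionBody (integrand)
open Literature.MathematicalPhysics.QuantumFieldTheory.Balaban1983to89.GaugeField (GaugeInvariant gaugeAct)
open Literature.MathematicalPhysics.QuantumFieldTheory.Balaban1983to89.B12EffectiveActionInvarianceT (hInvT_of_gaugeInvariant)
open Literature.MathematicalPhysics.QuantumFieldTheory.Balaban1983to89.B12ContinuousTransportInvariance (gaugeInvariant_effActionHT_succ_of_step)
open Literature.MathematicalPhysics.QuantumFieldTheory.Balaban1983to89.B12NodeKnitIndAPlug (thm3Member_of_indATPlug_of_hCompT)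
open Literature.MathematicalPhysics.QuantumFieldTheory.Balaban1983to89.B12NodeKnitRecord8 (b12_main_of_leaf_of_thm3Member)

variable {F : T4Family} {N : ℕ} [NeZero N]

/-! ## §1. Invariant-output transports: the effective actions are gauge invariant with NO χ hypothesis -/

/-- **NON-VACUITY OF THE HYPOTHESIS CLASS (degenerate witness)**: the ZERO transport `ρ ↦ 0` has gauge-invariant output at every torus, step and input.  (The intended
inhabitant, the Γ-averaged canonical-version transport, is a NODE 00 definition not built in this Theorems file.) [folklore] -/
theorem invariantOutput_zero : ∀ (K j : ℕ) (ρ : Density (F.P K) j (SU N)), GaugeInvariant ((fun _ _ _ => fun _ => (0 : ℝ) : Transport F N) K j ρ) :=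
  fun _ _ _ _ _ => rfl

/-- **EVERY EFFECTIVE ACTION IS GAUGE INVARIANT OVER AN INVARIANT-OUTPUT TRANSPORT, NO χ HYPOTHESIS**: `A_0 = −(1∕g_0²)A^η` is Wilson's
(`T4WilsonGaugeFlatDirection.gaugeInvariant_wilsonExponent`); `A_{j+1} = log 𝐍_j⁻¹ (T' K j ρ_j)(·)` reads an invariant function whatever `ρ_j` is (dag-n09-a MODULE 1
`gaugeInvariant_effActionHT_succ_of_step`).  No induction, no lift-invariance of `χ`, no support clause. [cite: Balaban1987RG1, (0.17)–(0.19) p.255 and p.263] -/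
theorem gaugeInvariant_effActionHT_of_invariantOutput (T' : Transport F N) (hT : ∀ (K j : ℕ) (ρ : Density (F.P K) j (SU N)), GaugeInvariant (T' K j ρ))
    (χ : (K : ℕ) → (ℕ → ℝ) → (k : ℕ) → Density (F.P K) k (SU N)) (K : ℕ) (g : ℕ → ℝ) :
    ∀ k, GaugeInvariant (effActionHT F N T' χ K g k)
  | 0 => fun v V => by rw [effActionHT_zero]; exact T4WilsonGaugeFlatDirection.gaugeInvariant_wilsonExponent _ _ v V
  | j + 1 => gaugeInvariant_effActionHT_succ_of_step T' χ K g j (hT K j _)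

/-- **`HInvT` AT EVERY LEVEL `k ≤ m + K` over an invariant-output transport, NO χ HYPOTHESIS** (g3's `hInvT_of_gaugeInvariant`: residual invariance of `A_j ∘ Ū^j` from
level-wise invariance + covariance of the iterated averages). [cite: Balaban1987RG1, (0.21) p.256 and (2.16) p.269] -/
theorem hInvT_of_invariantOutput (T' : Transport F N) (hT : ∀ (K j : ℕ) (ρ : Density (F.P K) j (SU N)), GaugeInvariant (T' K j ρ))
    (χ : (K : ℕ) → (ℕ → ℝ) → (k : ℕ) → Density (F.P K) k (SU N)) (K : ℕ) (g : ℕ → ℝ) {k : ℕ} (hk : k ≤ (F.P K).m + (F.P K).K) :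
    HInvT F N T' χ K g k :=
  hInvT_of_gaugeInvariant F N T' χ K g hk fun j _ => gaugeInvariant_effActionHT_of_invariantOutput T' hT χ K g j

/-- **N09's COMPOSITION INPUT `HCompT` FROM THE [B11] INPUTS ALONE over an invariant-output transport** (levels `k ≤ K` of the `K`-th torus): `HRestrict` + intermediate
(1.1)-uniqueness ⇒ `HOrbit` (def-B `hOrbit_of_hRestrict_of_unique`) ⇒ with `hInvT_of_invariantOutput` ⇒ `HCompT` (def-B `hCompT_of_hOrbit_of_hInvT`).  NO χ hypothesis, NO
nesting, NO regular set. [cite: Balaban1987RG1, (0.21)–(0.23) p.256, (1.1) p.260 and (2.16) p.269; Balaban1985Variational, Thm 1 (8)–(10) p.279] -/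
theorem hCompT_of_invariantOutput (T' : Transport F N) (hT : ∀ (K j : ℕ) (ρ : Density (F.P K) j (SU N)), GaugeInvariant (T' K j ρ))
    (χ : (K : ℕ) → (ℕ → ℝ) → (k : ℕ) → Density (F.P K) k (SU N)) {ε : ℝ} (K : ℕ) (g : ℕ → ℝ) {k : ℕ} (hk : k ≤ K)
    {dom : Set (GaugeField (F.P K) k (SU N))} (hres : HRestrict F N ε K k dom)
    (huniq : ∀ V ∈ dom, ∀ j < k, UniqueUkOrbit F N K (j + 1) ε (Averaging.iter (avOfRecord F N K) (j + 1) (Uk F N K k ε V))) :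
    HCompT F N T' χ ε K g k dom :=
  hCompT_of_hOrbit_of_hInvT F N T' χ (hOrbit_of_hRestrict_of_unique F N hres huniq)
    (hInvT_of_invariantOutput T' hT χ K g (hk.trans (Nat.le_add_left _ _)))

/-! ## §2. The Theorem-3 member ∕ N09 through the transport-generic plug over an invariant-output transport: [B11] Thm 1 ×3 ONLY -/

/-- **THE THEOREM-3 MEMBER OVER AN INVARIANT-OUTPUT TRANSPORT FROM [B11] THM 1 ALONE**: for a binding world whose run flow is `genFlow β P.g₀` and whose `IndAss k` IS
`IndAOfRecordT T' χ ε β …` at the record's own objects (χ local in the couplings, `hχ`), the member `smallCouplings → smallFieldInductive` follows from (1.1) on the domains,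
`HRestrict` and intermediate (1.1)-uniqueness — NO lift-invariance of χ, NO support clause, NO nesting, NO regular set (contrast dag-n24-c's located Stage-13 form with
(M1) ∕ (F7a) ∕ (F7b), forced by `TcanOfRecord`'s invariance ON `regSetOfRecord` only). [cite: Balaban1987RG1, Thm 3 p.264, (1.1)–(1.3) p.260, (0.22)–(0.23) p.256 and p.263; Balaban1985Variational, Thm 1 (8)–(10) p.279] -/
theorem thm3Member_of_indATPlug_of_invariantOutput {w : WorldP} {P : B12.RunParams} (T' : Transport F N)
    (hT : ∀ (K j : ℕ) (ρ : Density (F.P K) j (SU N)), GaugeInvariant (T' K j ρ))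
    (χ : (K : ℕ) → (ℕ → ℝ) → (k : ℕ) → Density (F.P K) k (SU N)) (ε : ℝ) (β : HBeta) (dom : (k : ℕ) → Set (GaugeField (F.P P.K) k (SU N)))
    (hflow : (w.C P).flow = genFlow β P.g0)
    (hind : ∀ k, k ≤ P.K → ((w.C P).IndAss k ↔
      IndAOfRecordT F N T' χ ε β P k (prefixOf (genSeq β P.g0) k) (dom k) (effActionOfRecordT F N T' χ β P k) (wilsonBGOfRecord F N ε P k)
        (EkOfRecordT F N T' χ ε β P k)))
    (hχ : ∀ k, k ≤ P.K → ∀ n ≤ k, χ P.K (extd (prefixOf (genSeq β P.g0) k)) n = χ P.K (genSeq β P.g0) n)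
    (h11 : ∀ k, k ≤ P.K → ∀ V ∈ dom k, UkExists F N P.K k ε V ∧ UniqueUkOrbit F N P.K k ε V)
    (hres : ∀ k, k ≤ P.K → HRestrict F N ε P.K k (dom k))
    (huniq : ∀ k, k ≤ P.K → ∀ V ∈ dom k, ∀ j < k,
      UniqueUkOrbit F N P.K (j + 1) ε (Averaging.iter (avOfRecord F N P.K) (j + 1) (Uk F N P.K k ε V))) :
    (leavesP w P).smallCouplings → (leavesP w P).smallFieldInductive :=
  thm3Member_of_indATPlug_of_hCompT T' χ ε β dom hflow hind hχ h11 fun k hk =>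
    hCompT_of_invariantOutput T' hT χ P.K (genSeq β P.g0) hk (hres k hk) (huniq k hk)

/-- **N09 AT `(w, P)` OVER AN INVARIANT-OUTPUT TRANSPORT**: own leaf `b12` + (1.1) + `HRestrict` + intermediate uniqueness ⇒ `Dag.B12_main (leavesP w P)`.
[cite: Balaban1987RG1, Lemma 4 (3.53) p.280, Thm 3 p.264 and (1.1)–(1.3) p.260; Balaban1985Variational, Thm 1 p.279] -/
theorem b12_main_of_indATPlug_of_leaf_of_invariantOutput {w : WorldP} {P : B12.RunParams} (T' : Transport F N)
    (hT : ∀ (K j : ℕ) (ρ : Density (F.P K) j (SU N)), GaugeInvariant (T' K j ρ))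
    (χ : (K : ℕ) → (ℕ → ℝ) → (k : ℕ) → Density (F.P K) k (SU N)) (ε : ℝ) (β : HBeta) (dom : (k : ℕ) → Set (GaugeField (F.P P.K) k (SU N)))
    (hflow : (w.C P).flow = genFlow β P.g0)
    (hind : ∀ k, k ≤ P.K → ((w.C P).IndAss k ↔
      IndAOfRecordT F N T' χ ε β P k (prefixOf (genSeq β P.g0) k) (dom k) (effActionOfRecordT F N T' χ β P k) (wilsonBGOfRecord F N ε P k)
        (EkOfRecordT F N T' χ ε β P k)))
    (hχ : ∀ k, k ≤ P.K → ∀ n ≤ k, χ P.K (extd (prefixOf (genSeq β P.g0) k)) n = χ P.K (genSeq β P.g0) n) (h12 : (leavesP w P).b12)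
    (h11 : ∀ k, k ≤ P.K → ∀ V ∈ dom k, UkExists F N P.K k ε V ∧ UniqueUkOrbit F N P.K k ε V)
    (hres : ∀ k, k ≤ P.K → HRestrict F N ε P.K k (dom k))
    (huniq : ∀ k, k ≤ P.K → ∀ V ∈ dom k, ∀ j < k,
      UniqueUkOrbit F N P.K (j + 1) ε (Averaging.iter (avOfRecord F N P.K) (j + 1) (Uk F N P.K k ε V))) :
    Dag.B12_main (leavesP w P) :=
  b12_main_of_leaf_of_thm3Member h12 (thm3Member_of_indATPlug_of_invariantOutput T' hT χ ε β dom hflow hind hχ h11 hres huniq)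

end Summit.QuantumFields.YangMills.BalabanUVNodes.N09InvariantTransportPlug

end
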